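import Summits.AnomalousDissipation.AnomalousDissipation.Theorems.DenseLoudDesignerForces.Negative.FluxCapacity

/-!
# Negative knowledge for the crux `DenseLoudDesignerForces` (stmt-AnomalousDissipation-1143), XIV: energy excursions
# and the period floor of low-energy loud orbits (witness anatomy V)

Certified copy of §17 of the cdisprove work file (generation 3): the energy of a classical orbit with steady force rises
above any earlier value only as fast as the force pumps it, `½‖u(t)‖² ≤ ½‖u(s)‖² + ‖F‖₂((t-s)∫_s^t‖u‖₂²)^{1/2}`
(`kineticEnergy_le_of_le`), so a `τ`-periodic orbit obeys `sup_t ∫‖u(t)‖² ≤ ⟨‖u‖²⟩ + 2τ‖F‖₂⟨‖u‖²⟩^{1/2}`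
(`energy_le_of_periodic`, from a slice below the mean, `exists_energy_le_mean`); with the capacity floor of
`Negative.FluxCapacity` a witness of `c ∈ LOUD_j(S,E,ε)` satisfies `ε - 4π²N²E/(j+1) ≤ 6πN√(#B_N)·W√W`,
`W = E + 2τ‖f_c‖₂√E` (`period_floor_of_loud`): loudness on a small energy budget costs period length.
Supports stmt-AnomalousDissipation-1143.
-/

noncomputable section

namespace Summit.AnomalousDissipation.AnomalousDissipation.Theorems.DenseLoudDesignerForces.Negative

open scoped BigOperators Topology ENNReal InnerProductSpace
open Filter Set MeasureTheory UnitAddTorus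
open Literature.Analysis.FunctionSpaces Literature.Analysis.FluidPDE
open Summit.AnomalousDissipation.AnomalousDissipation.Theses.BaireTransfer

/-! ## §17 Witness anatomy V: energy excursions and a PERIOD FLOOR for low-energy loud orbits

For a classical orbit with steady force the energy can rise above its period mean only as fast as the force pumps it:
`½‖u(t)‖² ≤ ½‖u(s)‖² + ‖F‖₂ ((t-s)∫_s^t‖u‖₂²)^{1/2}` (`kineticEnergy_le_of_le`), so over a period
`sup_t ∫‖u(t)‖² ≤ ⟨‖u‖²⟩ + 2τ‖F‖₂⟨‖u‖²⟩^{1/2}` (`energy_le_of_periodic`: start from a time where the energy is below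
its mean).  With the capacity floor of §16 this gives a PERIOD FLOOR (`period_floor_of_loud`):
`ε - 4π²N²E/(j+1) ≤ 6πN√(#B_N) · (E + 2τ‖f_c‖₂√E)^{3/2}` — a loud orbit whose energy budget `E` is small compared with
`(ε/(N√#B_N))^{2/3}` must have a LONG PERIOD, `τ ≳ ((ε/(6πN√#B_N))^{2/3} - E)/(2‖f_c‖₂√E)`: intermittent loudness
(rare energetic bursts) costs period length linearly. -/

section Period

variable {S : Finset (Fin 3 → ℤ)} {ν τ : ℝ} {F : (UnitAddTorus (Fin 3)) → (EuclideanSpace ℝ (Fin 3))} {c : ↥S → (EuclideanSpace ℂ (Fin 3))} {u : ℝ → (UnitAddTorus (Fin 3)) → (EuclideanSpace ℝ (Fin 3))} {p : ℝ → (UnitAddTorus (Fin 3)) → ℝ}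

/-- ENERGY EXCURSION BOUND: `½‖u(t)‖² ≤ ½‖u(s)‖² + √(∫‖F‖²) · √((t-s) ∫_s^t ‖u‖₂²)` for `s ≤ t` (`ν ≥ 0`). -/
theorem kineticEnergy_le_of_le (h : Torus.IsClassicalNSSolutionOn univ ν (fun _ => F) u p) (hν : 0 ≤ ν)
    {s t : ℝ} (hst : s ≤ t) :
    Torus.kineticEnergy (u t) ≤ Torus.kineticEnergy (u s) +
      Real.sqrt (∫ x, ‖F x‖ ^ 2) * Real.sqrt ((t - s) * ∫ r in s..t, ∫ x, ‖u r x‖ ^ 2) := by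
  have hu := h.smooth_velocity
  have hF : Torus.IsSmooth F := isSmooth_of_solution h
  have hE := h.energy_eq convex_univ hst (subset_univ _)
  have hG : 0 ≤ ν * ∫ r in s..t, Torus.gradNormSq (u r) :=
    mul_nonneg hν (intervalIntegral.integral_nonneg hst fun r _ => Torus.gradNormSq_nonneg _)
  set D : ℝ := ∫ r in s..t, ∫ x, ⟪F x, u r x⟫_ℝ with hDdef
  set A : ℝ := ∫ x, ‖F x‖ ^ 2 with hAdef
  set B : ℝ := ∫ r in s..t, ∫ x, ‖u r x‖ ^ 2 with hBdef
  have hA : 0 ≤ A := integral_nonneg fun _ => sq_nonneg _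
  have hB : 0 ≤ B := intervalIntegral.integral_nonneg hst fun r _ => integral_nonneg fun _ => sq_nonneg _
  have hKE : Torus.kineticEnergy (u t) ≤ Torus.kineticEnergy (u s) + D := by linarith
  have he_st : Torus.IsSmoothSpaceTimeOn univ (fun r x => ‖u r x‖ ^ 2) := by
    change ContDiffOn ℝ _ (fun z => ‖Torus.stLift u z‖ ^ 2) _
    exact hu.norm_sq ℝ
  have he_cont : Continuous fun r => ∫ x, ‖u r x‖ ^ 2 :=
    continuousOn_univ.1 (he_st.continuousOn_integral convex_univ)
  have hP_cont : Continuous fun r => ∫ x, ⟪F x, u r x⟫_ℝ :=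
    continuousOn_univ.1 (((Torus.isSmoothSpaceTimeOn_const hF univ).inner hu).continuousOn_integral convex_univ)
  -- `D² ≤ (t-s) A B` by the weighted AM–GM in space–time
  have hD2 : ∀ lam : ℝ, 0 < lam → 2 * D ≤ lam * ((t - s) * A) + B / lam := by
    intro lam hl
    have hspace : ∀ r, 2 * ∫ x, ⟪F x, u r x⟫_ℝ ≤ lam * A + (∫ x, ‖u r x‖ ^ 2) / lam := by
      intro r
      have hur : Torus.IsSmooth (u r) := hu.isSmooth_slice (mem_univ r)
      have hint1 : Integrable (fun x => ⟪F x, u r x⟫_ℝ) := (hF.inner hur).integrable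
      have hint2 : Integrable (fun x => lam * ‖F x‖ ^ 2 + ‖u r x‖ ^ 2 / lam) :=
        ((hF.norm_sq.integrable).const_mul lam).add (hur.norm_sq.integrable.div_const lam)
      have hpt : ∀ x, 2 * ⟪F x, u r x⟫_ℝ ≤ lam * ‖F x‖ ^ 2 + ‖u r x‖ ^ 2 / lam := fun x =>
        (mul_le_mul_of_nonneg_left (real_inner_le_norm _ _) zero_le_two).trans (two_mul_le_weighted hl)
      calc 2 * ∫ x, ⟪F x, u r x⟫_ℝ = ∫ x, 2 * ⟪F x, u r x⟫_ℝ := (integral_const_mul _ _).symm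
        _ ≤ ∫ x, (lam * ‖F x‖ ^ 2 + ‖u r x‖ ^ 2 / lam) := integral_mono (hint1.const_mul 2) hint2 hpt
        _ = lam * A + (∫ x, ‖u r x‖ ^ 2) / lam := by
            rw [integral_add ((hF.norm_sq.integrable).const_mul lam) (hur.norm_sq.integrable.div_const lam),
              integral_const_mul, integral_div]
    have hi1 : IntervalIntegrable (fun r => ∫ x, ⟪F x, u r x⟫_ℝ) volume s t := hP_cont.intervalIntegrable _ _
    have hi2 : IntervalIntegrable (fun r => lam * A + (∫ x, ‖u r x‖ ^ 2) / lam) volume s t :=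
      (continuous_const.add (he_cont.div_const lam)).intervalIntegrable _ _
    calc 2 * D = ∫ r in s..t, 2 * ∫ x, ⟪F x, u r x⟫_ℝ := (intervalIntegral.integral_const_mul _ _).symm
      _ ≤ ∫ r in s..t, (lam * A + (∫ x, ‖u r x‖ ^ 2) / lam) :=
          intervalIntegral.integral_mono_on hst (hi1.const_mul 2) hi2 fun r _ => hspace r
      _ = lam * ((t - s) * A) + B / lam := by
          rw [intervalIntegral.integral_add intervalIntegrable_const ((he_cont.div_const lam).intervalIntegrable _ _),
            intervalIntegral.integral_const, intervalIntegral.integral_div]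
          simp only [smul_eq_mul]
          ring
  rcases le_or_gt D 0 with hD0 | hDpos
  · have : 0 ≤ Real.sqrt A * Real.sqrt ((t - s) * B) := by positivity
    linarith
  · have hsq : D ^ 2 ≤ ((t - s) * A) * B :=
      sq_le_mul_of_forall_weighted (mul_nonneg (sub_nonneg.2 hst) hA) hB hDpos.le hD2
    have hD_le : D ≤ Real.sqrt A * Real.sqrt ((t - s) * B) := by
      rw [← Real.sqrt_mul hA, ← Real.sqrt_sq hDpos.le]
      exact Real.sqrt_le_sqrt (by nlinarith [hsq])
    linarith

/-- Over a period some slice has energy at most the mean: `∃ s ∈ [0,τ], ∫‖u(s)‖² ≤ ⟨‖u‖²⟩`. -/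
theorem exists_energy_le_mean (hu : Torus.IsSmoothSpaceTimeOn univ u) (hper : Function.Periodic u τ) (hτ : 0 < τ) :
    ∃ s ∈ Icc (0 : ℝ) τ, ∫ x, ‖u s x‖ ^ 2 ≤ meanEnergy u := by
  have he_st : Torus.IsSmoothSpaceTimeOn univ (fun r x => ‖u r x‖ ^ 2) := by
    change ContDiffOn ℝ _ (fun z => ‖Torus.stLift u z‖ ^ 2) _
    exact hu.norm_sq ℝ
  have he_cont : Continuous fun r => ∫ x, ‖u r x‖ ^ 2 :=
    continuousOn_univ.1 (he_st.continuousOn_integral convex_univ)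
  obtain ⟨s, hs, hmin⟩ := isCompact_Icc.exists_isMinOn (nonempty_Icc.2 hτ.le) he_cont.continuousOn
  refine ⟨s, hs, ?_⟩
  rw [meanEnergy_eq_period_mean hper hτ]
  -- `τ e(s) ≤ ∫₀^τ e`
  have hmono : ∫ r in (0 : ℝ)..τ, (∫ x, ‖u s x‖ ^ 2) ≤ ∫ r in (0 : ℝ)..τ, ∫ x, ‖u r x‖ ^ 2 :=
    intervalIntegral.integral_mono_on hτ.le intervalIntegrable_const (he_cont.intervalIntegrable _ _)
      fun r hr => hmin hr
  rw [intervalIntegral.integral_const, sub_zero, smul_eq_mul] at hmono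
  rw [le_inv_mul_iff₀ hτ]
  linarith

/-- SUP-ENERGY BOUND OF A PERIODIC ORBIT: `∫‖u(t)‖² ≤ ⟨‖u‖²⟩ + 2τ √(∫‖F‖²) √⟨‖u‖²⟩` for every `t`
(steady force, `ν ≥ 0`). -/
theorem energy_le_of_periodic (h : Torus.IsClassicalNSSolutionOn univ ν (fun _ => F) u p) (hν : 0 ≤ ν)
    (hper : Function.Periodic u τ) (hτ : 0 < τ) (t : ℝ) :
    ∫ x, ‖u t x‖ ^ 2 ≤ meanEnergy u + 2 * τ * Real.sqrt (∫ x, ‖F x‖ ^ 2) * Real.sqrt (meanEnergy u) := by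
  have hu := h.smooth_velocity
  obtain ⟨s, hs, hsE⟩ := exists_energy_le_mean hu hper hτ
  have hmE : 0 ≤ meanEnergy u := meanEnergy_nonneg' hper hτ
  -- reduce `t` into the window `[s, s + τ]`
  obtain ⟨n, hn⟩ : ∃ n : ℤ, t - n • τ ∈ Icc s (s + τ) := by
    refine ⟨⌊(t - s) / τ⌋, ?_, ?_⟩
    · have h1 := Int.floor_le ((t - s) / τ)
      rw [zsmul_eq_mul]
      have : (⌊(t - s) / τ⌋ : ℝ) * τ ≤ t - s := by rwa [le_div_iff₀ hτ] at h1
      linarith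
    · have h1 := Int.lt_floor_add_one ((t - s) / τ)
      rw [zsmul_eq_mul]
      have : t - s < ((⌊(t - s) / τ⌋ : ℝ) + 1) * τ := by rwa [div_lt_iff₀ hτ] at h1
      linarith
  set t' := t - n • τ with ht'
  have hut : u t = u t' := by
    rw [ht']
    exact (hper.sub_zsmul_eq n).symm
  have hst : s ≤ t' := hn.1
  have ht's : t' - s ≤ τ := by linarith [hn.2]
  have hK := kineticEnergy_le_of_le h hν hst
  -- `∫_s^{t'} e ≤ ∫_s^{s+τ} e = τ ⟨‖u‖²⟩`
  have he_st : Torus.IsSmoothSpaceTimeOn univ (fun r x => ‖u r x‖ ^ 2) := by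
    change ContDiffOn ℝ _ (fun z => ‖Torus.stLift u z‖ ^ 2) _
    exact hu.norm_sq ℝ
  have he_cont : Continuous fun r => ∫ x, ‖u r x‖ ^ 2 :=
    continuousOn_univ.1 (he_st.continuousOn_integral convex_univ)
  have he_per : Function.Periodic (fun r => ∫ x, ‖u r x‖ ^ 2) τ := fun r => by simp only [hper r]
  have hB : ∫ r in s..t', ∫ x, ‖u r x‖ ^ 2 ≤ τ * meanEnergy u := by
    have h1 : ∫ r in s..t', ∫ x, ‖u r x‖ ^ 2 ≤ ∫ r in s..(s + τ), ∫ x, ‖u r x‖ ^ 2 := by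
      rw [← intervalIntegral.integral_add_adjacent_intervals (a := s) (b := t') (c := s + τ)
        (he_cont.intervalIntegrable _ _) (he_cont.intervalIntegrable _ _)]
      have : 0 ≤ ∫ r in t'..(s + τ), ∫ x, ‖u r x‖ ^ 2 :=
        intervalIntegral.integral_nonneg (by linarith) fun r _ => integral_nonneg fun _ => sq_nonneg _
      linarith
    rw [he_per.intervalIntegral_add_eq s 0, zero_add] at h1
    rw [meanEnergy_eq_period_mean hper hτ, ← mul_assoc, mul_inv_cancel₀ hτ.ne', one_mul]
    exact h1
  have hA : 0 ≤ ∫ x, ‖F x‖ ^ 2 := integral_nonneg fun _ => sq_nonneg _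
  have hsqrt : Real.sqrt ((t' - s) * ∫ r in s..t', ∫ x, ‖u r x‖ ^ 2) ≤ τ * Real.sqrt (meanEnergy u) := by
    have hB0 : 0 ≤ ∫ r in s..t', ∫ x, ‖u r x‖ ^ 2 :=
      intervalIntegral.integral_nonneg hst fun r _ => integral_nonneg fun _ => sq_nonneg _
    calc Real.sqrt ((t' - s) * ∫ r in s..t', ∫ x, ‖u r x‖ ^ 2) ≤ Real.sqrt (τ * (τ * meanEnergy u)) :=
          Real.sqrt_le_sqrt (mul_le_mul ht's hB hB0 hτ.le)
      _ = τ * Real.sqrt (meanEnergy u) := by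
          rw [← mul_assoc, Real.sqrt_mul (mul_self_nonneg τ), Real.sqrt_mul_self hτ.le]
  rw [hut]
  unfold Torus.kineticEnergy at hK
  have h2 : Real.sqrt (∫ x, ‖F x‖ ^ 2) * Real.sqrt ((t' - s) * ∫ r in s..t', ∫ x, ‖u r x‖ ^ 2) ≤
      Real.sqrt (∫ x, ‖F x‖ ^ 2) * (τ * Real.sqrt (meanEnergy u)) :=
    mul_le_mul_of_nonneg_left hsqrt (Real.sqrt_nonneg _)
  nlinarith [hK, h2, hsE]

variable {E ε : ℝ}

/-- PERIOD FLOOR FOR LOW-ENERGY LOUD ORBITS: a witness of `c ∈ LOUD_j(S,E,ε)` with period `τ` satisfies, for every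
`N` with `S ⊆ B_N`, `ε - 4π²N²E/(j+1) ≤ 6πN√(#B_N) · W√W` with `W = E + 2τ‖f_c‖₂√E` — if `E√E` is small against
`ε/(6πN√#B_N)` the period must be long. -/
theorem period_floor_of_loud (hsol : Torus.IsClassicalNSSolutionOn univ ν (fun _ => force S c) u p)
    {N : ℕ} (hS : S ⊆ Torus.freqBall N) (hν : 0 < ν) {j : ℕ} (hνj : ν < 1 / ((j : ℝ) + 1))
    (hper : Function.Periodic u τ) (hτ : 0 < τ) (hEu : meanEnergy u ≤ E) (hεu : ε ≤ meanDissipation ν u) :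
    ε - 4 * Real.pi ^ 2 * (N : ℝ) ^ 2 * E / ((j : ℝ) + 1) ≤
      6 * Real.pi * (N : ℝ) * Real.sqrt ((Torus.freqBall (d := Fin 3) N).card) *
        ((E + 2 * τ * Real.sqrt (∫ x, ‖force S c x‖ ^ 2) * Real.sqrt E) *
          Real.sqrt (E + 2 * τ * Real.sqrt (∫ x, ‖force S c x‖ ^ 2) * Real.sqrt E)) := by
  have hu := hsol.smooth_velocity
  have hcap := capacity_floor_of_loud hsol hS hν hνj hper hτ hEu hεu
  have hmE := meanEnergy_nonneg' hper hτ
  have hE : 0 ≤ E := hmE.trans hEu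
  set W : ℝ := E + 2 * τ * Real.sqrt (∫ x, ‖force S c x‖ ^ 2) * Real.sqrt E with hW
  have hsup : ∀ t, ∫ x, ‖u t x‖ ^ 2 ≤ W := by
    intro t
    refine (energy_le_of_periodic hsol hν.le hper hτ t).trans ?_
    have h1 : Real.sqrt (meanEnergy u) ≤ Real.sqrt E := Real.sqrt_le_sqrt hEu
    have h2 : 0 ≤ 2 * τ * Real.sqrt (∫ x, ‖force S c x‖ ^ 2) := by positivity
    nlinarith [mul_le_mul_of_nonneg_left h1 h2]
  have hW0 : 0 ≤ W := (integral_nonneg fun _ => sq_nonneg _).trans (hsup 0)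
  -- pointwise: `√E_N ∫‖u‖² ≤ W √W`
  have hpt : ∀ t, Real.sqrt (lowEnergy N u t) * ∫ x, ‖u t x‖ ^ 2 ≤ W * Real.sqrt W := by
    intro t
    have h1 := capacity_le_cubic hu N t
    have h2 : Real.sqrt (∫ x, ‖u t x‖ ^ 2) ≤ Real.sqrt W := Real.sqrt_le_sqrt (hsup t)
    have h3 : 0 ≤ ∫ x, ‖u t x‖ ^ 2 := integral_nonneg fun _ => sq_nonneg _
    calc Real.sqrt (lowEnergy N u t) * ∫ x, ‖u t x‖ ^ 2 ≤ Real.sqrt (∫ x, ‖u t x‖ ^ 2) * ∫ x, ‖u t x‖ ^ 2 := h1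
      _ ≤ Real.sqrt W * W := mul_le_mul h2 (hsup t) h3 (Real.sqrt_nonneg _)
      _ = W * Real.sqrt W := mul_comm _ _
  have hmono : ∫ t in (0 : ℝ)..τ, Real.sqrt (lowEnergy N u t) * ∫ x, ‖u t x‖ ^ 2 ≤ ∫ t in (0 : ℝ)..τ, W * Real.sqrt W :=
    intervalIntegral.integral_mono_on hτ.le ((continuous_capacity hu N).intervalIntegrable _ _)
      intervalIntegrable_const fun t _ => hpt t
  rw [intervalIntegral.integral_const, sub_zero, smul_eq_mul] at hmono
  have hmean : τ⁻¹ * ∫ t in (0 : ℝ)..τ, Real.sqrt (lowEnergy N u t) * ∫ x, ‖u t x‖ ^ 2 ≤ W * Real.sqrt W := by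
    rw [inv_mul_le_iff₀ hτ]
    exact hmono
  have hK : 0 ≤ 6 * Real.pi * (N : ℝ) * Real.sqrt ((Torus.freqBall (d := Fin 3) N).card) := by positivity
  exact hcap.trans (mul_le_mul_of_nonneg_left hmean hK)

end Period

end Summit.AnomalousDissipation.AnomalousDissipation.Theorems.DenseLoudDesignerForces.Negative

end
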